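import Summits.QuantumFields.YangMills.Theorems.AllWindowsColdBoxBoxHighLineRestrictionSetCrossParityReduce

/-!
# U5 K4′ rows R6/R7 (part 2) — the CROSS term `CROSS(X, Y; Uᵒ, Uᵉ)` over a SYMMETRIC cut set `μ_{D′}`: the Hölder (4,4,2) bound in Gaussian letters

Free-hands helper of the κ-lineage (ym-line-fcl-p3 g27) for LEAD ym-line-sfw-p2 g78's K4′ term table (`ym-idea-1/g78-K4PRIME-TERM-TABLE.md`, rows R6/R7,
offered to this seat 2026-08-30T00:49:58Z; U5 = `stub_landauThirdOrder`, ⟨stmt-QuantumFields-24336⟩, UNSTAFFED).  After (S1)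
`κ₄,₀(X,Y;Uᵒ+Uᵉ) = κ₄,₀(X,Y;Uᵒ) + κ₄,₀(X,Y;Uᵉ) + 2·CROSS(X,Y;Uᵒ,Uᵉ)` (✓`GaussRestrict.tiltCum4_muSet_zero_add_third`) the cross term between the ODD tilt part
`A = Uᵒ` and the EVEN tilt part `V = Uᵉ` of two parity-split observables `X = Xᵉ + Xᵒ`, `Y = Yᵉ + Yᵒ` loses five of its pieces by parity on a symmetric `D′`.
Over `μ_D := (volume.restrict D).withDensity (ofReal ∘ gaussWeight β H)` for an ARBITRARY measurable symmetric `D` (`hsym : ∀ a, −a ∈ D ↔ a ∈ D`) and observables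
measurable and bounded on `D`, with `E := Tilt.tiltExp μ_D W 0` in ANY tilt letter `W`:

* (part 1, `…RestrictionSetCrossParityReduce`) §1 helpers over `μ_D`: `tiltExp_muSet_zero_nonneg_on`, `tiltExp_muSet_zero_mono_on`, `abs_tiltExp_muSet_zero_pair_le` (Cauchy–Schwarz),
  `tiltExp_muSet_zero_centredSq_le` (`E[(V − E V)²] ≤ E[(V − b)²]`, any `b`);
* §2 ★ `cross_muSet_zero_parity_reduce`:
  `CROSS_W(Xᵉ+Xᵒ, Yᵉ+Yᵒ; A, V) = E[X̃ᵉ·Yᵒ·A·Ṽ] + E[Xᵒ·Ỹᵉ·A·Ṽ] − E[Xᵒ·A]·E[Ỹᵉ·Ṽ] − E[X̃ᵉ·Ṽ]·E[Yᵒ·A]`  (`X̃ᵉ = Xᵉ − E Xᵉ`, `Ṽ = V − E V`);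
* §3 ★★ `abs_cross_muSet_zero_parity_le_gaussAvg`: with `E₀[1 − 1_D] ≤ τ ≤ 1/2`, `sup_D |Xᵉ| ≤ S_X`, `sup_D |Yᵉ| ≤ S_Y` and ANY constant `b`,
  `|CROSS| ≤ 2S_X·√(√(2E₀[1_D Yᵒ⁴])·√(2E₀[1_D A⁴]))·√(2E₀[1_D(V−b)²]) + 2S_Y·√(√(2E₀[1_D Xᵒ⁴])·√(2E₀[1_D A⁴]))·√(2E₀[1_D(V−b)²])`
  `+ √(2E₀[1_D Xᵒ²])·√(2E₀[1_D A²])·(2S_Y·√(2E₀[1_D(V−b)²])) + (2S_X·√(2E₀[1_D(V−b)²]))·(√(2E₀[1_D Yᵒ²])·√(2E₀[1_D A²]))`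
  — the sizes stay in `E₀`-letters so the assembler plugs ✓13K-G (`gaussAvg_sfInd_odd_pow_four_le`), the `Uᵒ` letters of R2/R3 and RU (✓13K-U) by name.

No definitions; standard axioms.  HONEST LABEL: helper-grade glue for K4′ of an UNSTAFFED stub; ⟨24004⟩ ⟨24336⟩ remain OPEN; route AllWindowsColdBox is DRAFT;
no crux, rung or summit is proved; the Yang–Mills mass gap is NOT proved by this file; no summit is proved by a line.
-/

set_option autoImplicit false

noncomputable section

open MeasureTheory Set

namespace Summit.QuantumFields.YangMills.Theorems.AllWindowsColdBoxBoxHighLine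

namespace GaussRestrict

variable {H : ℕ} {β : ℝ}

/-! ## §3 The Hölder (4,4,2) bound in Gaussian letters -/

/-- ★★ **R6/R7 bound**: over a symmetric measurable `D` with `E₀[1 − 1_D] ≤ τ ≤ 1/2`, for `Xᵉ, Yᵉ, V` even and `Xᵒ, Yᵒ, A` odd (measurable, bounded by `B` on
`D`), `sup_D |Xᵉ| ≤ S_X`, `sup_D |Yᵉ| ≤ S_Y`, and ANY constant `b`, the cross term is bounded by
`2S_X·√(√(2E₀[1_D Yᵒ⁴])·√(2E₀[1_D A⁴]))·√(2E₀[1_D(V−b)²]) + 2S_Y·√(√(2E₀[1_D Xᵒ⁴])·√(2E₀[1_D A⁴]))·√(2E₀[1_D(V−b)²])`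
`+ (√(2E₀[1_D Xᵒ²])·√(2E₀[1_D A²]))·(2S_Y·√(2E₀[1_D(V−b)²])) + (2S_X·√(2E₀[1_D(V−b)²]))·(√(2E₀[1_D Yᵒ²])·√(2E₀[1_D A²]))`. -/
theorem abs_cross_muSet_zero_parity_le_gaussAvg (hβ : 0 < β) {D : Set (LandauFree H → E3)} (hDm : MeasurableSet D) (hsym : ∀ a, -a ∈ D ↔ a ∈ D)
    {τ : ℝ} (hτ : gaussAvg β H (fun a => 1 - D.indicator (fun _ => (1 : ℝ)) a) ≤ τ) (hτ2 : τ ≤ 1 / 2) (W : (LandauFree H → E3) → ℝ)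
    {Xe Xo Ye Yo A V : (LandauFree H → E3) → ℝ} {B S_X S_Y : ℝ} (hB : 0 ≤ B) (hSX : 0 ≤ S_X) (hSY : 0 ≤ S_Y)
    (mXe : Measurable Xe) (mXo : Measurable Xo) (mYe : Measurable Ye) (mYo : Measurable Yo) (mA : Measurable A) (mV : Measurable V)
    (bXe : ∀ a ∈ D, |Xe a| ≤ B) (bXo : ∀ a ∈ D, |Xo a| ≤ B) (bYe : ∀ a ∈ D, |Ye a| ≤ B) (bYo : ∀ a ∈ D, |Yo a| ≤ B)
    (bA : ∀ a ∈ D, |A a| ≤ B) (bV : ∀ a ∈ D, |V a| ≤ B) (sXe : ∀ a ∈ D, |Xe a| ≤ S_X) (sYe : ∀ a ∈ D, |Ye a| ≤ S_Y)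
    (pXe : ∀ a, Xe (-a) = Xe a) (pXo : ∀ a, Xo (-a) = -Xo a) (pYe : ∀ a, Ye (-a) = Ye a) (pYo : ∀ a, Yo (-a) = -Yo a)
    (pA : ∀ a, A (-a) = -A a) (pV : ∀ a, V (-a) = V a) (b : ℝ) :
    let μD : Measure (LandauFree H → E3) := (((volume : Measure (LandauFree H → E3)).restrict D).withDensity fun a => ENNReal.ofReal (gaussWeight β H a))
    let E : ((LandauFree H → E3) → ℝ) → ℝ := fun G => Tilt.tiltExp μD W 0 G
    |E (fun a => (Xe a + Xo a - E (fun a => Xe a + Xo a)) * (Ye a + Yo a - E (fun a => Ye a + Yo a)) * (A a - E A) * (V a - E V)) -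
        E (fun a => (Xe a + Xo a - E (fun a => Xe a + Xo a)) * (Ye a + Yo a - E (fun a => Ye a + Yo a))) * E (fun a => (A a - E A) * (V a - E V)) -
        E (fun a => (Xe a + Xo a - E (fun a => Xe a + Xo a)) * (A a - E A)) * E (fun a => (Ye a + Yo a - E (fun a => Ye a + Yo a)) * (V a - E V)) -
        E (fun a => (Xe a + Xo a - E (fun a => Xe a + Xo a)) * (V a - E V)) * E (fun a => (Ye a + Yo a - E (fun a => Ye a + Yo a)) * (A a - E A))| ≤
      2 * S_X * Real.sqrt (Real.sqrt (2 * gaussAvg β H (fun a => D.indicator (fun _ => (1 : ℝ)) a * Yo a ^ 4)) *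
            Real.sqrt (2 * gaussAvg β H (fun a => D.indicator (fun _ => (1 : ℝ)) a * A a ^ 4))) *
          Real.sqrt (2 * gaussAvg β H (fun a => D.indicator (fun _ => (1 : ℝ)) a * (V a - b) ^ 2)) +
        2 * S_Y * Real.sqrt (Real.sqrt (2 * gaussAvg β H (fun a => D.indicator (fun _ => (1 : ℝ)) a * Xo a ^ 4)) *
            Real.sqrt (2 * gaussAvg β H (fun a => D.indicator (fun _ => (1 : ℝ)) a * A a ^ 4))) *
          Real.sqrt (2 * gaussAvg β H (fun a => D.indicator (fun _ => (1 : ℝ)) a * (V a - b) ^ 2)) +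
        Real.sqrt (2 * gaussAvg β H (fun a => D.indicator (fun _ => (1 : ℝ)) a * Xo a ^ 2)) *
            Real.sqrt (2 * gaussAvg β H (fun a => D.indicator (fun _ => (1 : ℝ)) a * A a ^ 2)) *
          (2 * S_Y * Real.sqrt (2 * gaussAvg β H (fun a => D.indicator (fun _ => (1 : ℝ)) a * (V a - b) ^ 2))) +
        2 * S_X * Real.sqrt (2 * gaussAvg β H (fun a => D.indicator (fun _ => (1 : ℝ)) a * (V a - b) ^ 2)) *
          (Real.sqrt (2 * gaussAvg β H (fun a => D.indicator (fun _ => (1 : ℝ)) a * Yo a ^ 2)) *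
            Real.sqrt (2 * gaussAvg β H (fun a => D.indicator (fun _ => (1 : ℝ)) a * A a ^ 2))) := by
  intro μD E
  have hD := integral_indicator_mul_gaussWeight_pos hβ hDm hτ hτ2
  have hred := cross_muSet_zero_parity_reduce hβ hDm hsym hD W hB mXe mXo mYe mYo mA mV bXe bXo bYe bYo bA bV pXe pXo pYe pYo pA pV
  simp only at hred
  rw [show E (fun a => (Xe a + Xo a - E (fun a => Xe a + Xo a)) * (Ye a + Yo a - E (fun a => Ye a + Yo a)) * (A a - E A) * (V a - E V)) -
        E (fun a => (Xe a + Xo a - E (fun a => Xe a + Xo a)) * (Ye a + Yo a - E (fun a => Ye a + Yo a))) * E (fun a => (A a - E A) * (V a - E V)) -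
        E (fun a => (Xe a + Xo a - E (fun a => Xe a + Xo a)) * (A a - E A)) * E (fun a => (Ye a + Yo a - E (fun a => Ye a + Yo a)) * (V a - E V)) -
        E (fun a => (Xe a + Xo a - E (fun a => Xe a + Xo a)) * (V a - E V)) * E (fun a => (Ye a + Yo a - E (fun a => Ye a + Yo a)) * (A a - E A)) = _
      from hred]
  set cx := E Xe with hcx
  set cy := E Ye with hcy
  set cv := E V with hcv
  -- bounds on D
  have bcx : |cx| ≤ S_X := abs_tiltExp_muSet_zero_le hβ hDm hD W hSX sXe
  have bcy : |cy| ≤ S_Y := abs_tiltExp_muSet_zero_le hβ hDm hD W hSY sYe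
  have bcxB : |cx| ≤ B := abs_tiltExp_muSet_zero_le hβ hDm hD W hB bXe
  have bcyB : |cy| ≤ B := abs_tiltExp_muSet_zero_le hβ hDm hD W hB bYe
  have bcv : |cv| ≤ B := abs_tiltExp_muSet_zero_le hβ hDm hD W hB bV
  have cXS : ∀ a ∈ D, |Xe a - cx| ≤ 2 * S_X := fun a ha => (abs_sub _ _).trans (by linarith [sXe a ha])
  have cYS : ∀ a ∈ D, |Ye a - cy| ≤ 2 * S_Y := fun a ha => (abs_sub _ _).trans (by linarith [sYe a ha])
  -- a common crude bound `K` for every product below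
  set K : ℝ := (2 * B + 1) ^ 4 with hK
  have hB1 : 1 ≤ 2 * B + 1 := by linarith only [hB]
  have hK1 : 1 ≤ K := one_le_pow₀ hB1
  have hK0 : 0 ≤ K := zero_le_one.trans hK1
  have up : ∀ {z : ℝ}, |z| ≤ 2 * B + 1 → |z| ≤ K := fun hz => hz.trans (by rw [hK]; exact le_self_pow₀ hB1 (by norm_num))
  have cX : ∀ a ∈ D, |Xe a - cx| ≤ 2 * B + 1 := fun a ha => (abs_sub _ _).trans (by linarith only [bXe a ha, bcxB])
  have cY : ∀ a ∈ D, |Ye a - cy| ≤ 2 * B + 1 := fun a ha => (abs_sub _ _).trans (by linarith only [bYe a ha, bcyB])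
  have cV : ∀ a ∈ D, |V a - cv| ≤ 2 * B + 1 := fun a ha => (abs_sub _ _).trans (by linarith only [bV a ha, bcv])
  have dXo : ∀ a ∈ D, |Xo a| ≤ 2 * B + 1 := fun a ha => (bXo a ha).trans (by linarith only [hB])
  have dYo : ∀ a ∈ D, |Yo a| ≤ 2 * B + 1 := fun a ha => (bYo a ha).trans (by linarith only [hB])
  have dA : ∀ a ∈ D, |A a| ≤ 2 * B + 1 := fun a ha => (bA a ha).trans (by linarith only [hB])
  have dVb : ∀ a ∈ D, |V a - b| ≤ B + |b| := fun a ha => (abs_sub _ _).trans (add_le_add (bV a ha) le_rfl)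
  have prodK : ∀ {P Q : (LandauFree H → E3) → ℝ}, (∀ a ∈ D, |P a| ≤ 2 * B + 1) → (∀ a ∈ D, |Q a| ≤ 2 * B + 1) →
      ∀ a ∈ D, |P a * Q a| ≤ K := by
    intro P Q hP hQ a ha
    rw [abs_mul]
    calc |P a| * |Q a| ≤ (2 * B + 1) * (2 * B + 1) := mul_le_mul (hP a ha) (hQ a ha) (abs_nonneg _) (by linarith only [hB])
      _ = (2 * B + 1) ^ 2 := by ring
      _ ≤ K := by rw [hK]; exact pow_le_pow_right₀ hB1 (by norm_num)
  -- measurability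
  have mcX : Measurable fun a => Xe a - cx := mXe.sub measurable_const
  have mcY : Measurable fun a => Ye a - cy := mYe.sub measurable_const
  have mcV : Measurable fun a => V a - cv := mV.sub measurable_const
  have mXY : Measurable fun a => (Xe a - cx) * Yo a := mcX.mul mYo
  have mYX : Measurable fun a => Xo a * (Ye a - cy) := mXo.mul mcY
  -- nonnegativity constants
  have nSX : 0 ≤ 2 * S_X := by linarith only [hSX]
  have nSY : 0 ≤ 2 * S_Y := by linarith only [hSY]
  have nSX2 : 0 ≤ (2 * S_X) ^ 2 := sq_nonneg _
  have nSY2 : 0 ≤ (2 * S_Y) ^ 2 := sq_nonneg _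
  have nSX4 : 0 ≤ (2 * S_X) ^ 4 := pow_nonneg nSX 4
  have nSY4 : 0 ≤ (2 * S_Y) ^ 4 := pow_nonneg nSY 4
  have hK4 : 0 ≤ K ^ 4 := pow_nonneg hK0 4
  -- ### R6, first piece
  have trip1 := abs_tiltExp_muSet_triple_le β hDm W 0 hK0 mXY mA mcV (prodK cX dYo) (fun a ha => up (dA a ha)) (fun a ha => up (cV a ha))
  have mono1 : Tilt.tiltExp μD W 0 (fun a => ((Xe a - cx) * Yo a) ^ 4) ≤ Tilt.tiltExp μD W 0 (fun a => (2 * S_X) ^ 4 * Yo a ^ 4) := by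
    refine tiltExp_muSet_zero_mono_on hβ hDm hD W (B := K ^ 4 + ((2 * S_X) ^ 4) * K ^ 4) (by linarith only [hK4, mul_nonneg nSX4 hK4])
      (mXY.pow_const 4) ((mYo.pow_const 4).const_mul _) (fun a ha => ?_) (fun a ha => ?_) (fun a ha => ?_)
    · rw [abs_pow]
      have h1 := pow_le_pow_left₀ (abs_nonneg _) (prodK cX dYo a ha) 4
      linarith only [h1, mul_nonneg nSX4 hK4]
    · rw [abs_mul, abs_pow, abs_pow, abs_of_nonneg nSX]
      have h1 := pow_le_pow_left₀ (abs_nonneg _) (up (dYo a ha)) 4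
      have h2 := mul_le_mul_of_nonneg_left h1 nSX4
      linarith only [h2, hK4]
    · rw [show ((Xe a - cx) * Yo a) ^ 4 = (Xe a - cx) ^ 4 * Yo a ^ 4 by ring]
      refine mul_le_mul_of_nonneg_right ?_ (by positivity)
      have h := pow_le_pow_left₀ (abs_nonneg _) (cXS a ha) 4
      rwa [Even.pow_abs ⟨2, rfl⟩] at h
  rw [Tilt.tiltExp_const_mul] at mono1
  -- ### R6, second piece
  have trip2 := abs_tiltExp_muSet_triple_le β hDm W 0 hK0 mYX mA mcV (prodK dXo cY) (fun a ha => up (dA a ha)) (fun a ha => up (cV a ha))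
  have mono2 : Tilt.tiltExp μD W 0 (fun a => (Xo a * (Ye a - cy)) ^ 4) ≤ Tilt.tiltExp μD W 0 (fun a => (2 * S_Y) ^ 4 * Xo a ^ 4) := by
    refine tiltExp_muSet_zero_mono_on hβ hDm hD W (B := K ^ 4 + ((2 * S_Y) ^ 4) * K ^ 4) (by linarith only [hK4, mul_nonneg nSY4 hK4])
      (mYX.pow_const 4) ((mXo.pow_const 4).const_mul _) (fun a ha => ?_) (fun a ha => ?_) (fun a ha => ?_)
    · rw [abs_pow]
      have h1 := pow_le_pow_left₀ (abs_nonneg _) (prodK dXo cY a ha) 4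
      linarith only [h1, mul_nonneg nSY4 hK4]
    · rw [abs_mul, abs_pow, abs_pow, abs_of_nonneg nSY]
      have h1 := pow_le_pow_left₀ (abs_nonneg _) (up (dXo a ha)) 4
      have h2 := mul_le_mul_of_nonneg_left h1 nSY4
      linarith only [h2, hK4]
    · rw [show (Xo a * (Ye a - cy)) ^ 4 = (Ye a - cy) ^ 4 * Xo a ^ 4 by ring]
      refine mul_le_mul_of_nonneg_right ?_ (by positivity)
      have h := pow_le_pow_left₀ (abs_nonneg _) (cYS a ha) 4
      rwa [Even.pow_abs ⟨2, rfl⟩] at h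
  rw [Tilt.tiltExp_const_mul] at mono2
  -- ### R7 pieces: Cauchy–Schwarz
  have h2B1 : 0 ≤ 2 * B + 1 := by linarith only [hB]
  have cs3a := abs_tiltExp_muSet_zero_pair_le (β := β) hDm W h2B1 mXo mA dXo dA
  have cs3b := abs_tiltExp_muSet_zero_pair_le (β := β) hDm W h2B1 mcY mcV cY cV
  have cs4a := abs_tiltExp_muSet_zero_pair_le (β := β) hDm W h2B1 mcX mcV cX cV
  have cs4b := abs_tiltExp_muSet_zero_pair_le (β := β) hDm W h2B1 mYo mA dYo dA
  have vY : Tilt.tiltExp μD W 0 (fun a => (Ye a - cy) ^ 2) ≤ (2 * S_Y) ^ 2 := by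
    have h := abs_tiltExp_muSet_zero_le hβ hDm hD W (B := (2 * S_Y) ^ 2) (sq_nonneg _) (F := fun a => (Ye a - cy) ^ 2) fun a ha => by
      rw [abs_pow]; exact pow_le_pow_left₀ (abs_nonneg _) (cYS a ha) 2
    exact (le_abs_self _).trans h
  have vX : Tilt.tiltExp μD W 0 (fun a => (Xe a - cx) ^ 2) ≤ (2 * S_X) ^ 2 := by
    have h := abs_tiltExp_muSet_zero_le hβ hDm hD W (B := (2 * S_X) ^ 2) (sq_nonneg _) (F := fun a => (Xe a - cx) ^ 2) fun a ha => by
      rw [abs_pow]; exact pow_le_pow_left₀ (abs_nonneg _) (cXS a ha) 2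
    exact (le_abs_self _).trans h
  -- ### Gaussian letters for every μ_D-moment
  have mI : Measurable (D.indicator (fun _ => (1 : ℝ))) := measurable_const.indicator hDm
  have gauss : ∀ {G : (LandauFree H → E3) → ℝ} (n : ℕ) {C : ℝ}, Measurable G → (∀ a ∈ D, |G a| ≤ C) →
      Tilt.tiltExp μD W 0 (fun a => G a ^ (2 * n)) ≤ 2 * gaussAvg β H (fun a => D.indicator (fun _ => (1 : ℝ)) a * G a ^ (2 * n)) := by
    intro G n C mG bG
    have eG : ∀ a ∈ D, G a ^ (2 * n) = D.indicator (fun _ => (1 : ℝ)) a * G a ^ (2 * n) := fun a ha => by rw [Set.indicator_of_mem ha, one_mul]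
    rw [tiltExp_muSet_congr_on β hDm W 0 eG]
    have h0 : 0 ≤ fun a => D.indicator (fun _ => (1 : ℝ)) a * G a ^ (2 * n) := fun a =>
      mul_nonneg (indicator_one_nonneg_le_one D a).1 (by rw [pow_mul]; exact pow_nonneg (sq_nonneg _) n)
    have hI : Integrable fun a => D.indicator (fun _ => (1 : ℝ)) a * G a ^ (2 * n) * gaussWeight β H a := by
      refine Tilt.integrable_bdd_mul_gaussWeight H hβ (mI.mul (mG.pow_const _)) (C := (max C 0) ^ (2 * n)) fun a => ?_
      by_cases ha : a ∈ D
      · rw [Set.indicator_of_mem ha, one_mul, abs_pow]; exact pow_le_pow_left₀ (abs_nonneg _) ((bG a ha).trans (le_max_left _ _)) _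
      · rw [Set.indicator_of_notMem ha, zero_mul, abs_zero]; exact pow_nonneg (le_max_right _ _) _
    exact tiltExp_muSet_zero_le_two_mul_gaussAvg hβ hDm hτ hτ2 W h0 hI
  have gYo4 := gauss 2 mYo dYo
  have gXo4 := gauss 2 mXo dXo
  have gA4 := gauss 2 mA dA
  have gXo2 := gauss 1 mXo dXo
  have gYo2 := gauss 1 mYo dYo
  have gA2 := gauss 1 mA dA
  have gVb := gauss 1 (mV.sub measurable_const) dVb
  simp only [Nat.mul_one, show 2 * 2 = 4 from rfl] at gYo4 gXo4 gA4 gXo2 gYo2 gA2 gVb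
  have vV := (tiltExp_muSet_zero_centredSq_le hβ hDm hD W hB mV bV b).trans gVb
  -- ### assemble: square roots
  have h1a := mono1.trans (mul_le_mul_of_nonneg_left gYo4 nSX4)
  have h1 : Real.sqrt (Tilt.tiltExp μD W 0 (fun a => ((Xe a - cx) * Yo a) ^ 4)) ≤
      (2 * S_X) ^ 2 * Real.sqrt (2 * gaussAvg β H (fun a => D.indicator (fun _ => (1 : ℝ)) a * Yo a ^ 4)) := by
    have h := Real.sqrt_le_sqrt h1a
    rw [show (2 * S_X) ^ 4 * (2 * gaussAvg β H (fun a => D.indicator (fun _ => (1 : ℝ)) a * Yo a ^ 4)) =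
      ((2 * S_X) ^ 2) ^ 2 * (2 * gaussAvg β H (fun a => D.indicator (fun _ => (1 : ℝ)) a * Yo a ^ 4)) by ring,
      Real.sqrt_mul (sq_nonneg _), Real.sqrt_sq nSX2] at h
    exact h
  have h2a := mono2.trans (mul_le_mul_of_nonneg_left gXo4 nSY4)
  have h2 : Real.sqrt (Tilt.tiltExp μD W 0 (fun a => (Xo a * (Ye a - cy)) ^ 4)) ≤
      (2 * S_Y) ^ 2 * Real.sqrt (2 * gaussAvg β H (fun a => D.indicator (fun _ => (1 : ℝ)) a * Xo a ^ 4)) := by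
    have h := Real.sqrt_le_sqrt h2a
    rw [show (2 * S_Y) ^ 4 * (2 * gaussAvg β H (fun a => D.indicator (fun _ => (1 : ℝ)) a * Xo a ^ 4)) =
      ((2 * S_Y) ^ 2) ^ 2 * (2 * gaussAvg β H (fun a => D.indicator (fun _ => (1 : ℝ)) a * Xo a ^ 4)) by ring,
      Real.sqrt_mul (sq_nonneg _), Real.sqrt_sq nSY2] at h
    exact h
  have hA4 : Real.sqrt (Tilt.tiltExp μD W 0 (fun a => A a ^ 4)) ≤ Real.sqrt (2 * gaussAvg β H (fun a => D.indicator (fun _ => (1 : ℝ)) a * A a ^ 4)) :=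
    Real.sqrt_le_sqrt gA4
  have r1 : Real.sqrt (Real.sqrt (Tilt.tiltExp μD W 0 (fun a => ((Xe a - cx) * Yo a) ^ 4)) * Real.sqrt (Tilt.tiltExp μD W 0 (fun a => A a ^ 4))) ≤
      2 * S_X * Real.sqrt (Real.sqrt (2 * gaussAvg β H (fun a => D.indicator (fun _ => (1 : ℝ)) a * Yo a ^ 4)) *
        Real.sqrt (2 * gaussAvg β H (fun a => D.indicator (fun _ => (1 : ℝ)) a * A a ^ 4))) := by
    have h3 := Real.sqrt_le_sqrt (mul_le_mul h1 hA4 (Real.sqrt_nonneg _) (mul_nonneg nSX2 (Real.sqrt_nonneg _)))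
    rw [mul_assoc, Real.sqrt_mul nSX2, Real.sqrt_sq nSX] at h3
    exact h3
  have r2 : Real.sqrt (Real.sqrt (Tilt.tiltExp μD W 0 (fun a => (Xo a * (Ye a - cy)) ^ 4)) * Real.sqrt (Tilt.tiltExp μD W 0 (fun a => A a ^ 4))) ≤
      2 * S_Y * Real.sqrt (Real.sqrt (2 * gaussAvg β H (fun a => D.indicator (fun _ => (1 : ℝ)) a * Xo a ^ 4)) *
        Real.sqrt (2 * gaussAvg β H (fun a => D.indicator (fun _ => (1 : ℝ)) a * A a ^ 4))) := by
    have h3 := Real.sqrt_le_sqrt (mul_le_mul h2 hA4 (Real.sqrt_nonneg _) (mul_nonneg nSY2 (Real.sqrt_nonneg _)))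
    rw [mul_assoc, Real.sqrt_mul nSY2, Real.sqrt_sq nSY] at h3
    exact h3
  have rV : Real.sqrt (Tilt.tiltExp μD W 0 (fun a => (V a - cv) ^ 2)) ≤ Real.sqrt (2 * gaussAvg β H (fun a => D.indicator (fun _ => (1 : ℝ)) a * (V a - b) ^ 2)) :=
    Real.sqrt_le_sqrt vV
  have rXo2 : Real.sqrt (Tilt.tiltExp μD W 0 (fun a => Xo a ^ 2)) ≤ Real.sqrt (2 * gaussAvg β H (fun a => D.indicator (fun _ => (1 : ℝ)) a * Xo a ^ 2)) :=
    Real.sqrt_le_sqrt gXo2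
  have rYo2 : Real.sqrt (Tilt.tiltExp μD W 0 (fun a => Yo a ^ 2)) ≤ Real.sqrt (2 * gaussAvg β H (fun a => D.indicator (fun _ => (1 : ℝ)) a * Yo a ^ 2)) :=
    Real.sqrt_le_sqrt gYo2
  have rA2 : Real.sqrt (Tilt.tiltExp μD W 0 (fun a => A a ^ 2)) ≤ Real.sqrt (2 * gaussAvg β H (fun a => D.indicator (fun _ => (1 : ℝ)) a * A a ^ 2)) :=
    Real.sqrt_le_sqrt gA2
  have rY : Real.sqrt (Tilt.tiltExp μD W 0 (fun a => (Ye a - cy) ^ 2)) ≤ 2 * S_Y := by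
    have h := Real.sqrt_le_sqrt vY; rw [Real.sqrt_sq nSY] at h; exact h
  have rX : Real.sqrt (Tilt.tiltExp μD W 0 (fun a => (Xe a - cx) ^ 2)) ≤ 2 * S_X := by
    have h := Real.sqrt_le_sqrt vX; rw [Real.sqrt_sq nSX] at h; exact h
  -- nonnegativity of the Gaussian-letter square roots
  have z1 : 0 ≤ 2 * S_X * Real.sqrt (Real.sqrt (2 * gaussAvg β H (fun a => D.indicator (fun _ => (1 : ℝ)) a * Yo a ^ 4)) *
      Real.sqrt (2 * gaussAvg β H (fun a => D.indicator (fun _ => (1 : ℝ)) a * A a ^ 4))) := mul_nonneg nSX (Real.sqrt_nonneg _)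
  have z2 : 0 ≤ 2 * S_Y * Real.sqrt (Real.sqrt (2 * gaussAvg β H (fun a => D.indicator (fun _ => (1 : ℝ)) a * Xo a ^ 4)) *
      Real.sqrt (2 * gaussAvg β H (fun a => D.indicator (fun _ => (1 : ℝ)) a * A a ^ 4))) := mul_nonneg nSY (Real.sqrt_nonneg _)
  have zV : 0 ≤ Real.sqrt (2 * gaussAvg β H (fun a => D.indicator (fun _ => (1 : ℝ)) a * (V a - b) ^ 2)) := Real.sqrt_nonneg _
  -- the four term bounds
  have B1 : |E (fun a => (Xe a - cx) * Yo a * A a * (V a - cv))| ≤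
      2 * S_X * Real.sqrt (Real.sqrt (2 * gaussAvg β H (fun a => D.indicator (fun _ => (1 : ℝ)) a * Yo a ^ 4)) *
          Real.sqrt (2 * gaussAvg β H (fun a => D.indicator (fun _ => (1 : ℝ)) a * A a ^ 4))) *
        Real.sqrt (2 * gaussAvg β H (fun a => D.indicator (fun _ => (1 : ℝ)) a * (V a - b) ^ 2)) := by
    show |Tilt.tiltExp μD W 0 _| ≤ _
    exact trip1.trans (mul_le_mul r1 rV (Real.sqrt_nonneg _) z1)
  have B2 : |E (fun a => Xo a * (Ye a - cy) * A a * (V a - cv))| ≤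
      2 * S_Y * Real.sqrt (Real.sqrt (2 * gaussAvg β H (fun a => D.indicator (fun _ => (1 : ℝ)) a * Xo a ^ 4)) *
          Real.sqrt (2 * gaussAvg β H (fun a => D.indicator (fun _ => (1 : ℝ)) a * A a ^ 4))) *
        Real.sqrt (2 * gaussAvg β H (fun a => D.indicator (fun _ => (1 : ℝ)) a * (V a - b) ^ 2)) := by
    show |Tilt.tiltExp μD W 0 _| ≤ _
    exact trip2.trans (mul_le_mul r2 rV (Real.sqrt_nonneg _) z2)
  have B3 : |E (fun a => Xo a * A a) * E (fun a => (Ye a - cy) * (V a - cv))| ≤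
      Real.sqrt (2 * gaussAvg β H (fun a => D.indicator (fun _ => (1 : ℝ)) a * Xo a ^ 2)) *
          Real.sqrt (2 * gaussAvg β H (fun a => D.indicator (fun _ => (1 : ℝ)) a * A a ^ 2)) *
        (2 * S_Y * Real.sqrt (2 * gaussAvg β H (fun a => D.indicator (fun _ => (1 : ℝ)) a * (V a - b) ^ 2))) := by
    show |Tilt.tiltExp μD W 0 _ * Tilt.tiltExp μD W 0 _| ≤ _
    rw [abs_mul]
    exact mul_le_mul (cs3a.trans (mul_le_mul rXo2 rA2 (Real.sqrt_nonneg _) (Real.sqrt_nonneg _)))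
      (cs3b.trans (mul_le_mul rY rV (Real.sqrt_nonneg _) nSY)) (abs_nonneg _) (mul_nonneg (Real.sqrt_nonneg _) (Real.sqrt_nonneg _))
  have B4 : |E (fun a => (Xe a - cx) * (V a - cv)) * E (fun a => Yo a * A a)| ≤
      2 * S_X * Real.sqrt (2 * gaussAvg β H (fun a => D.indicator (fun _ => (1 : ℝ)) a * (V a - b) ^ 2)) *
        (Real.sqrt (2 * gaussAvg β H (fun a => D.indicator (fun _ => (1 : ℝ)) a * Yo a ^ 2)) *
          Real.sqrt (2 * gaussAvg β H (fun a => D.indicator (fun _ => (1 : ℝ)) a * A a ^ 2))) := by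
    show |Tilt.tiltExp μD W 0 _ * Tilt.tiltExp μD W 0 _| ≤ _
    rw [abs_mul]
    exact mul_le_mul (cs4a.trans (mul_le_mul rX rV (Real.sqrt_nonneg _) nSX))
      (cs4b.trans (mul_le_mul rYo2 rA2 (Real.sqrt_nonneg _) (Real.sqrt_nonneg _))) (abs_nonneg _) (mul_nonneg nSX zV)
  have habs : ∀ (p q r s : ℝ), |p + q - r - s| ≤ |p| + |q| + |r| + |s| := fun p q r s => by
    have h1 := abs_sub (p + q - r) s
    have h2 := abs_sub (p + q) r
    have h3 := abs_add_le p q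
    linarith only [h1, h2, h3]
  refine (habs _ _ _ _).trans ?_
  linarith only [B1, B2, B3, B4]


end GaussRestrict

end Summit.QuantumFields.YangMills.Theorems.AllWindowsColdBoxBoxHighLine

end
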